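import Literature.NumberTheory.EllipticCurves.QuadOrderPicardTower
import HarnessLib

/-!
# The kernel ideals `𝔞_v = v𝒪_{cℓ} + ℓ𝒪_c` of `Pic(𝒪_{cℓ}) → Pic(𝒪_c)` for a prime `ℓ ∤ c`
# (Cox, *Primes of the form x² + ny²*, §7.D (7.27): the coprime step `(𝒪_K/ℓ)^× / (ℤ/ℓ)^× → Pic`)

Topic `NumberTheory/EllipticCurves` (sequel of `QuadOrderPicardTower.lean`, whose kernel ideals
`kerFrac h p t = (1 + t)𝒪_d + p𝒪_c`, `kerUnit`, treat the step `Pic(𝒪_{cp}) → Pic(𝒪_c)` for a prime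
`p ∣ c`: there `𝔞_t` is inverted by `𝔞_{−t}` because `t² ∈ p𝒪_c`). Namespace
`Literature.NumberTheory.EllipticCurves.QuadOrderTower`. THEOREMS ONLY + one `Units` packaging with a body
(no named fact, no `sorry`, no instance).

For a prime `ℓ` NOT dividing `c` and `d = cℓ` the kernel of `Pic(𝒪_d) → Pic(𝒪_c)` is Cox's
`(𝒪_K/ℓ𝒪_K)^× / (ℤ/ℓ)^×` (Cox Thm. 7.24 with (7.27): the exact sequence
`1 → (ℤ/f)^× → (𝒪_K/f𝒪_K)^× → Pic(𝒪_f) → Pic(𝒪_K) → 1` up to units, read at the two levels `f = c` and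
`f = cℓ`, `(𝒪_K/cℓ)^× = (𝒪_K/c)^× × (𝒪_K/ℓ)^×`); its elements are represented by the proper `𝒪_d`-ideals
**`𝔞_v := v𝒪_d + ℓ𝒪_c`** for `v ∈ 𝒪_c` with norm `N(v) = v v̄` prime to `ℓ` (the class of `v mod ℓ`). In the
tree's vocabulary `𝔞_v = kerFrac h ℓ (v − 1)` VERBATIM (`(1 + (v − 1))𝒪_d + ℓ𝒪_c`), so the whole
`kerFrac` API applies; what is new for `ℓ ∤ c` is the INVERSE: `𝔞_v · 𝔞_{v̄} = 𝒪_d` when `v v̄ = n ∈ ℤ`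
is prime to `ℓ` (`a n + b ℓ = 1` gives `1 = a·v v̄ + ab·v(ℓv̄) + b²·ℓ·ℓ ∈ 𝔞_v 𝔞_{v̄}`), and `𝔞_v 𝒪_c = 𝒪_c`
by the same Bézout identity. This file proves exactly that (§1), packages `𝔞_v` as a unit of the monoid
of fractional `𝒪_d`-ideals (`kerUnitOf`, §2) and shows its class lies in the kernel of the tree's
`picRes : Pic(𝒪_d) → Pic(𝒪_c)` (`picRes_mk_kerUnitOf`). §3 EXHAUSTION for `ℓ` inert, phrased as
ANISOTROPY mod `ℓ` of the norm form `X² + tXY − mY²` of `𝓞_K = ℤ ⊕ ℤω` (`hanis`; the bridge from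
"`ℓ` inert" to `hanis` is not in this file): every invertible `𝔞` with `𝔞𝒪_c = 𝒪_c` is some `𝔞_u`
(`exists_coe_eq_kerFrac_sub_one`, the analogue of the `p ∣ c` file's `exists_eq_kerUnit`, reusing its
`coe_units_eq_one_of_one_le`), and every kernel class is `1` or `[𝔞_{k + cω}]` with `0 ≤ k < ℓ`
(`eq_one_or_exists_eq_mk_kerUnitLine`: the `P¹(𝔽_ℓ)`-family `kerUnitLine`; so the kernel has at most
`ℓ + 1` elements). §4 DISTINCTNESS when `𝒪_c^× = {±1}` (`hunits`; e.g. `K` imaginary quadratic, `c ≥ 2`, tree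
`coe_units_quadOrder_eq_one_or_eq_neg_one`): `[𝔞_{k+cω}] ≠ 1`, the classes for `0 ≤ k < ℓ` are pairwise
distinct (`mk_kerUnitLine_injOn`, via `mem_of_mk_kerUnitOf_eq` + coordinate comparison as in the `p ∣ c`
file's `dvd_sub_of_mk_kerUnit_eq`), the kernel is `{1} ∪ {[𝔞_{k+cω}]}` (`filter_picRes_eq_one_eq`) of
cardinality `ℓ + 1` (`card_filter_picRes_eq_one`, `…_of_isPrime`); and the bridge
`anisotropic_of_span_natCast_isPrime`: `ℓ𝓞_K` prime ⇒ `hanis`. §5 MULTIPLICATIVITY `𝔞_u𝔞_v = 𝔞_{uv}`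
(`kerFrac_sub_one_mul_kerFrac_sub_one_eq`) and congruence-invariance (`kerFrac_sub_one_eq_of_sub_eq`):
the ideal-theoretic form of the homomorphism `(𝒪_K/ℓ)^× → ker` (the group-level packaging and the
cyclicity of the kernel — a generator `σ_ℓ` of order `ℓ + 1` — are left to a sequel, `-- TODO`).
§6 RESIDUES for `ℓ ∤ c` (Cox, proof of (7.27): `𝒪_c/ℓ𝒪_c ≅ 𝓞_K/ℓ𝓞_K`): every class mod `ℓ𝓞_K` has a
representative in `𝒪_c` (`exists_mem_quadOrder_sub_eq_natCast_mul`) and `𝒪_c ∩ ℓ𝓞_K = ℓ𝒪_c`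
(`mem_quadOrder_of_natCast_mul_mem`).
USE: the `ℓ + 1` sublattices `𝔞_v J` of index `ℓ²` in a Gross point `J` of conductor `c` (Bertolini–Darmon
1996 §2.4–2.5, the Kolyvagin norm relation at a prime `ℓ ∤ c` inert in `K`) have conductor `cℓ`; with
`GrossPointsExistence.exists_heegnerFamily` (compatible families) this is the algebraic input of the norm
relation `Σ_{σ ∈ ker} σ x_{cℓ} ↔ T_ℓ x_c` on the definite side.

## References
* [Cox2013] D. A. Cox, *Primes of the form x² + ny²*, 2nd ed. (2013), §7.A Lemma 7.2 (`𝒪_f = ℤ + f𝒪_K`),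
  §7.D Thm. 7.24 with (7.25)–(7.27), Cor. 7.28 (held `book:cox2013-primes-form-i-x-sup-2-sup`, chunks p0159–p0161).
* [BertoliniDarmon1996] M. Bertolini, H. Darmon, *Heegner points on Mumford–Tate curves*, Invent. Math. 126
  (1996), §2.3–2.5 (the action of `Pic(𝒪_c)`, the norm-compatible families).
-/

noncomputable section

open scoped nonZeroDivisors
open NumberField Module
open Literature.NumberTheory.QuadraticFields.Quadratic

namespace Literature.NumberTheory.EllipticCurves

namespace QuadOrderTower

universe u

variable {K : Type u} [Field K]

/-! ### §1 `𝔞_v = v𝒪_d + ℓ𝒪_c = kerFrac h ℓ (v − 1)`: membership, inverse, triviality over `𝒪_c` -/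

section Coprime

variable {c d : ℕ} [NumberField K] [NeZero d]

/-- Helper: membership in a fractional ideal is membership in its submodule. [folklore] -/
private theorem mem_fi' {R : Type*} [CommRing R] {S : Submonoid R} {P : Type*} [CommRing P] [Algebra R P]
    {I : FractionalIdeal S P} {x : P} : x ∈ I ↔ x ∈ (I : Submodule R P) := Iff.rfl

/-- A fractional ideal is closed under addition. [folklore] -/
private theorem add_mem_fi' {R : Type*} [CommRing R] {S : Submonoid R} {P : Type*} [CommRing P]
    [Algebra R P] {I : FractionalIdeal S P} {x y : P} (hx : x ∈ I) (hy : y ∈ I) : x + y ∈ I :=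
  Submodule.add_mem _ hx hy

/-- **Membership in `𝔞_v = v𝒪_d + ℓ𝒪_c`**: `x = u v + ℓ r` with `u ∈ 𝒪_d`, `r ∈ 𝒪_c` (the tree's
`mem_kerFrac_iff` at `t = v − 1`). [cite: Cox2013, §7.D Thm. 7.24, (7.27)] -/
theorem mem_kerFrac_sub_one_iff (h : c ∣ d) {ℓ : ℕ} {v x : K} :
    x ∈ kerFrac h ℓ (v - 1) ↔ ∃ u ∈ quadOrder K d, ∃ r ∈ quadOrder K c, x = u * v + (ℓ : K) * r := by
  rw [mem_kerFrac_iff]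
  simp only [add_sub_cancel]

/-- `a v ∈ 𝔞_v` for an integer `a`. [cite: Cox2013, §7.D Thm. 7.24, (7.27)] -/
theorem intCast_mul_mem_kerFrac_sub_one (h : c ∣ d) {ℓ : ℕ} {v : K} (a : ℤ) :
    (a : K) * v ∈ kerFrac h ℓ (v - 1) :=
  (mem_kerFrac_sub_one_iff h).mpr ⟨a, Subalgebra.intCast_mem _ a, 0, Subalgebra.zero_mem _, by simp⟩

/-- `v ∈ 𝔞_v`. [cite: Cox2013, §7.D Thm. 7.24, (7.27)] -/
theorem self_mem_kerFrac_sub_one (h : c ∣ d) {ℓ : ℕ} {v : K} : v ∈ kerFrac h ℓ (v - 1) := by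
  simpa using intCast_mul_mem_kerFrac_sub_one (K := K) h (ℓ := ℓ) (v := v) 1

/-- `ℓ r ∈ 𝔞_v` for `r ∈ 𝒪_c`; in particular `ℓ ∈ 𝔞_v`. [cite: Cox2013, §7.D Thm. 7.24, (7.27)] -/
theorem natCast_mul_mem_kerFrac_sub_one (h : c ∣ d) {ℓ : ℕ} {v r : K} (hr : r ∈ quadOrder K c) :
    (ℓ : K) * r ∈ kerFrac h ℓ (v - 1) :=
  natCast_mul_mem_kerFrac h hr

/-- **`𝔞_v ⊆ 𝒪_d`-span… `𝔞_v · 𝔞_{v'} = 𝒪_d`** for `d = cℓ`, `v, v' ∈ 𝒪_c` with `v v' = n ∈ ℤ` prime to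
`ℓ` (take `v' = v̄`, `n = N(v)`): `⊆` since `(uv + ℓr)(u'v' + ℓr') = uu'n + ℓ(uvr' + u'v'r + ℓrr')` and
`ℓ𝒪_c ⊆ 𝒪_{cℓ}`; `⊇` since `an + bℓ = 1` gives `1 = a(v·v') + ab(v·ℓv') + b²(ℓ·ℓ)`. This is the
invertibility of the kernel ideals in the coprime step of Cox's (7.27). [cite: Cox2013, §7.D Thm. 7.24 (7.25)–(7.27), Cor. 7.28] -/
theorem kerFrac_sub_one_mul_kerFrac_sub_one {ℓ : ℕ} (hd : d = c * ℓ) {v v' : K}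
    (hv : v ∈ quadOrder K c) (hv' : v' ∈ quadOrder K c) {n : ℤ} (hvv' : v * v' = n)
    (hn : IsCoprime n ℓ) :
    kerFrac (Dvd.intro ℓ hd.symm) ℓ (v - 1) * kerFrac (Dvd.intro ℓ hd.symm) ℓ (v' - 1) = 1 := by
  have h : c ∣ d := Dvd.intro ℓ hd.symm
  apply le_antisymm
  · rw [FractionalIdeal.mul_le]
    intro x hx y hy
    obtain ⟨u, hu, r, hr, rfl⟩ := (mem_kerFrac_sub_one_iff h).mp hx
    obtain ⟨u', hu', r', hr', rfl⟩ := (mem_kerFrac_sub_one_iff h).mp hy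
    have e : (u * v + (ℓ : K) * r) * (u' * v' + (ℓ : K) * r') =
        u * u' * (n : K) + (ℓ : K) * (u * v * r' + u' * v' * r + (ℓ : K) * (r * r')) := by
      rw [← hvv']; ring
    rw [e, FractionalIdeal.mem_one_iff]
    have hu₁ := quadOrder_le_of_dvd h hu
    have hu'₁ := quadOrder_le_of_dvd h hu'
    refine ⟨⟨_, Subalgebra.add_mem _ (Subalgebra.mul_mem _ (Subalgebra.mul_mem _ hu hu')
      (Subalgebra.intCast_mem _ n)) (natCast_mul_mem_quadOrder_of_eq_mul hd ?_)⟩, rfl⟩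
    exact Subalgebra.add_mem _ (Subalgebra.add_mem _
      (Subalgebra.mul_mem _ (Subalgebra.mul_mem _ hu₁ hv) hr')
      (Subalgebra.mul_mem _ (Subalgebra.mul_mem _ hu'₁ hv') hr))
      (Subalgebra.mul_mem _ (Subalgebra.natCast_mem _ ℓ) (Subalgebra.mul_mem _ hr hr'))
  · obtain ⟨a, b, hab⟩ := hn
    have hab' : (a : K) * n + b * ℓ = 1 := by exact_mod_cast congrArg (fun z : ℤ => (z : K)) hab
    -- `1 = a(v·v') + ab(v·ℓv') + b²(ℓ·ℓ)`, each product in `𝔞_v 𝔞_{v'}`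
    have hmem : (a : K) * v * v' + ((a * b : ℤ) : K) * v * ((ℓ : K) * v') +
        (ℓ : K) * ((b * b : ℤ) : K) * ((ℓ : K) * 1) ∈
        kerFrac h ℓ (v - 1) * kerFrac h ℓ (v' - 1) :=
      add_mem_fi' (add_mem_fi'
        (FractionalIdeal.mul_mem_mul (intCast_mul_mem_kerFrac_sub_one h a) (self_mem_kerFrac_sub_one h))
        (FractionalIdeal.mul_mem_mul (intCast_mul_mem_kerFrac_sub_one h (a * b))
          (natCast_mul_mem_kerFrac_sub_one h hv')))
        (FractionalIdeal.mul_mem_mul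
          (natCast_mul_mem_kerFrac_sub_one h (Subalgebra.intCast_mem _ (b * b)))
          (natCast_mul_mem_kerFrac_sub_one h (Subalgebra.one_mem _)))
    have e : (a : K) * v * v' + ((a * b : ℤ) : K) * v * ((ℓ : K) * v') +
        (ℓ : K) * ((b * b : ℤ) : K) * ((ℓ : K) * 1) = 1 := by
      push_cast
      linear_combination ((1 : K) + (b : K) * ℓ) * hab' + ((a : K) + a * b * ℓ) * hvv'
    rw [e] at hmem
    exact FractionalIdeal.one_le.mpr hmem

/-- **`𝔞_v 𝒪_c = 𝒪_c`** for `v, v' ∈ 𝒪_c` with `v v' = n ∈ ℤ` prime to `ℓ`: `⊆` as `𝔞_v ⊆ 𝒪_c`; `⊇` since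
`x = (an + bℓ)x = (av)(v'x) + ℓ(bx)`. Hence `[𝔞_v] ↦ 1` in `Pic(𝒪_c)`. [cite: Cox2013, §7.D Thm. 7.24 (7.25)–(7.27), Cor. 7.28] -/
theorem kerFrac_sub_one_mul_upFrac (h : c ∣ d) {ℓ : ℕ} {v v' : K} (hv : v ∈ quadOrder K c)
    (hv' : v' ∈ quadOrder K c) {n : ℤ} (hvv' : v * v' = n) (hn : IsCoprime n ℓ) :
    kerFrac h ℓ (v - 1) * upFrac h = upFrac h := by
  apply le_antisymm
  · calc kerFrac h ℓ (v - 1) * upFrac h ≤ upFrac h * upFrac h :=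
          mul_le_mul_left (kerFrac_le_upFrac h (Subalgebra.sub_mem _ hv (Subalgebra.one_mem _))) _
      _ = upFrac h := upFrac_mul_upFrac h
  · intro x hx
    rw [mem_fi', FractionalIdeal.mem_coe, mem_upFrac_iff] at hx
    obtain ⟨a, b, hab⟩ := hn
    have hab' : (a : K) * n + b * ℓ = 1 := by exact_mod_cast congrArg (fun z : ℤ => (z : K)) hab
    have e : x = (a : K) * v * (v' * x) + (ℓ : K) * 1 * ((b : K) * x) := by
      linear_combination (-x) * hab' + (-(a : K) * x) * hvv'
    rw [mem_fi', FractionalIdeal.mem_coe, e]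
    refine add_mem_fi'
      (FractionalIdeal.mul_mem_mul (intCast_mul_mem_kerFrac_sub_one h a)
        ((mem_upFrac_iff h).mpr (Subalgebra.mul_mem _ hv' hx)))
      (FractionalIdeal.mul_mem_mul (natCast_mul_mem_kerFrac_sub_one h (Subalgebra.one_mem _))
        ((mem_upFrac_iff h).mpr (Subalgebra.mul_mem _ (Subalgebra.intCast_mem _ b) hx)))

end Coprime

/-! ### §2 The kernel units `𝔞_v` and `picRes [𝔞_v] = 1` -/

section Units

variable {c d : ℕ} [NumberField K] [NeZero d]

/-- **The kernel unit `𝔞_v = v𝒪_d + ℓ𝒪_c`** (`d = cℓ`, `v, v' ∈ 𝒪_c` with `v v' = n ∈ ℤ` prime to `ℓ`;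
inverse `𝔞_{v'}`), an invertible fractional `𝒪_{cℓ}`-ideal — the image of `[v] ∈ (𝒪_K/ℓ)^×` in the
kernel of `Pic(𝒪_{cℓ}) → Pic(𝒪_c)` (coprime step of Cox's (7.27)). Non-`Prop` packaging with a body.
[cite: Cox2013, §7.D Thm. 7.24 (7.25)–(7.27), Cor. 7.28] -/
def kerUnitOf {ℓ : ℕ} (hd : d = c * ℓ) {v v' : K} (hv : v ∈ quadOrder K c) (hv' : v' ∈ quadOrder K c)
    {n : ℤ} (hvv' : v * v' = n) (hn : IsCoprime n ℓ) : (FractionalIdeal (quadOrder K d)⁰ K)ˣ where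
  val := kerFrac (Dvd.intro ℓ hd.symm) ℓ (v - 1)
  inv := kerFrac (Dvd.intro ℓ hd.symm) ℓ (v' - 1)
  val_inv := kerFrac_sub_one_mul_kerFrac_sub_one hd hv hv' hvv' hn
  inv_val := kerFrac_sub_one_mul_kerFrac_sub_one hd hv' hv (by rw [mul_comm]; exact hvv') hn

/-- The underlying fractional ideal of `kerUnitOf`. [cite: Cox2013, §7.D Thm. 7.24, (7.27)] -/
theorem coe_kerUnitOf {ℓ : ℕ} (hd : d = c * ℓ) {v v' : K} (hv : v ∈ quadOrder K c)
    (hv' : v' ∈ quadOrder K c) {n : ℤ} (hvv' : v * v' = n) (hn : IsCoprime n ℓ) :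
    ((kerUnitOf hd hv hv' hvv' hn : (FractionalIdeal (quadOrder K d)⁰ K)ˣ) : FractionalIdeal _ K) =
      kerFrac (Dvd.intro ℓ hd.symm) ℓ (v - 1) :=
  rfl

/-- `𝔞_v · 𝒪_c = 𝒪_c` for the kernel unit. [cite: Cox2013, §7.D Thm. 7.24 (7.25)–(7.27), Cor. 7.28] -/
theorem kerUnitOf_mul_upFrac {ℓ : ℕ} (hd : d = c * ℓ) {v v' : K} (hv : v ∈ quadOrder K c)
    (hv' : v' ∈ quadOrder K c) {n : ℤ} (hvv' : v * v' = n) (hn : IsCoprime n ℓ) :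
    (kerUnitOf hd hv hv' hvv' hn : FractionalIdeal (quadOrder K d)⁰ K) * upFrac (Dvd.intro ℓ hd.symm) =
      upFrac (Dvd.intro ℓ hd.symm) :=
  kerFrac_sub_one_mul_upFrac _ hv hv' hvv' hn

variable [NeZero c]

/-- **`[𝔞_v]` lies in the kernel**: `extUnits (kerUnitOf …) = 1`. [cite: Cox2013, §7.D Thm. 7.24 (7.25)–(7.27), Cor. 7.28] -/
theorem extUnits_kerUnitOf {ℓ : ℕ} (hd : d = c * ℓ) {v v' : K} (hv : v ∈ quadOrder K c)
    (hv' : v' ∈ quadOrder K c) {n : ℤ} (hvv' : v * v' = n) (hn : IsCoprime n ℓ) :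
    extUnits K (Dvd.intro ℓ hd.symm) (kerUnitOf hd hv hv' hvv' hn) = 1 := by
  ext1
  rw [coe_extUnits, Units.val_one, extFrac_eq_one_iff]
  exact kerUnitOf_mul_upFrac hd hv hv' hvv' hn

/-- **`picRes [𝔞_v] = 1`** in `Pic(𝒪_c)`. [cite: Cox2013, §7.D Thm. 7.24 (7.25)–(7.27), Cor. 7.28] -/
theorem picRes_mk_kerUnitOf {ℓ : ℕ} (hd : d = c * ℓ) {v v' : K} (hv : v ∈ quadOrder K c)
    (hv' : v' ∈ quadOrder K c) {n : ℤ} (hvv' : v * v' = n) (hn : IsCoprime n ℓ) :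
    picRes K (Dvd.intro ℓ hd.symm) (ClassGroup.mk K (kerUnitOf hd hv hv' hvv' hn)) = 1 := by
  rw [picRes_mk, extUnits_kerUnitOf, map_one]

end Units

/-! ### §3 Exhaustion of the kernel for `ℓ` inert: every kernel class is `[𝔞_{X + Yω}]` -/

section Exhaust

variable {c d : ℕ} [NumberField K] [NeZero c] [NeZero d] (b : Basis (Fin 2) ℤ (𝓞 K)) (hb : b 0 = 1)
  {ℓ : ℕ} [hp : Fact ℓ.Prime]

omit [NumberField K] [NeZero c] [NeZero d] hp in
include hb in
/-- `ω² = m + tω` in `K` (`m = mConst b`, `t = tConst b`; copy of the tree's private `omega_mul_omega`).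
[cite: Cox2013, §7.A Lemma 7.2 (𝓞_K = [1, ω])] -/
private theorem omega_sq : omega b * omega b = (mConst b : K) + (tConst b : K) * omega b := by
  have h' := congrArg (algebraMap (𝓞 K) K) (basis_one_mul_self_eq b hb)
  simpa [omega, mConst, tConst] using h'

omit [NumberField K] [NeZero c] [NeZero d] hp in
include hb in
/-- **Norm form**: `(X + Yω)((X + tY) − Yω) = X² + tXY − mY²` — an element of `𝓞_K` times its conjugate
is its norm, an integer. [cite: Cox2013, §7.A (7.2)–(7.3) (norms and the conjugate in an order)] -/
theorem coords_mul_conj (X Y : ℤ) :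
    ((X : K) + (Y : K) * omega b) * (((X + tConst b * Y : ℤ) : K) + ((-Y : ℤ) : K) * omega b) =
      ((X ^ 2 + tConst b * X * Y - mConst b * Y ^ 2 : ℤ) : K) := by
  have hω := omega_sq b hb
  push_cast
  linear_combination (-((Y : K) ^ 2)) * hω

omit [NeZero c] [NeZero d] hp in
include hb in
/-- `ℓ r ≠ 1` for `r ∈ 𝒪_c` (`ℓ > 1`; compare `ω`-free coordinates). [folklore] -/
private theorem natCast_mul_ne_one (hℓ : 1 < ℓ) {r : K} (hr : r ∈ quadOrder K c) : (ℓ : K) * r ≠ 1 := by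
  intro h1
  obtain ⟨R, S, -, rfl⟩ := (mem_quadOrder_iff_coords b hb).mp hr
  have e : ((ℓ * R : ℤ) : K) + ((ℓ * S : ℤ) : K) * omega b = ((1 : ℤ) : K) + ((0 : ℤ) : K) * omega b := by
    push_cast; linear_combination h1
  obtain ⟨hR, -⟩ := coords_unique b hb e
  have : (ℓ : ℤ) ∣ 1 := ⟨R, hR.symm⟩
  have h2 : (ℓ : ℤ) ≤ 1 := Int.le_of_dvd one_pos this
  omega

include hb in
/-- **Every invertible `𝒪_{cℓ}`-ideal `𝔞` with `𝔞𝒪_c = 𝒪_c` is a kernel ideal `𝔞_u`, `u = X + Yω ∈ 𝒪_c`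
with `N(u) = X² + tXY − mY²` prime to `ℓ`**, for a prime `ℓ ∤ c` at which the norm form of `𝓞_K` is
ANISOTROPIC mod `ℓ` (`hanis`; for `(1, ω)` a basis this says `ℓ` is inert in `K`): `ℓ𝒪_c ⊆ 𝔞 ⊆ 𝒪_c`;
some `u ∈ 𝔞` is not in `ℓ𝒪_c` (else `1 ∈ 𝔞𝒪_c ⊆ ℓ𝒪_c`), its norm is prime to `ℓ` by anisotropy, so
`𝔞_u ⊆ 𝔞` is invertible (§1) and `𝔞_u⁻¹𝔞 ⊇ 𝒪_d` with `(𝔞_u⁻¹𝔞)𝒪_c = 𝒪_c` is `𝒪_d` by the tree's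
`coe_units_eq_one_of_one_le`. This is the surjectivity of `(𝒪_K/ℓ)^× → ker(Pic(𝒪_{cℓ}) → Pic(𝒪_c))`
in Cox's (7.27). [cite: Cox2013, §7.D Thm. 7.24 (7.25)–(7.27), Cor. 7.28] -/
theorem exists_coe_eq_kerFrac_sub_one (hd : d = c * ℓ) (hℓc : ¬ ℓ ∣ c)
    (hanis : ∀ X Y : ℤ, (ℓ : ℤ) ∣ X ^ 2 + tConst b * X * Y - mConst b * Y ^ 2 →
      (ℓ : ℤ) ∣ X ∧ (ℓ : ℤ) ∣ Y)
    (𝔞 : (FractionalIdeal (quadOrder K d)⁰ K)ˣ)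
    (h1 : (𝔞 : FractionalIdeal (quadOrder K d)⁰ K) * upFrac (Dvd.intro ℓ hd.symm) =
      upFrac (Dvd.intro ℓ hd.symm)) :
    ∃ X Y : ℤ, (c : ℤ) ∣ Y ∧ IsCoprime (X ^ 2 + tConst b * X * Y - mConst b * Y ^ 2) ℓ ∧
      (𝔞 : FractionalIdeal (quadOrder K d)⁰ K) =
        kerFrac (Dvd.intro ℓ hd.symm) ℓ (((X : K) + (Y : K) * omega b) - 1) := by
  have h : c ∣ d := Dvd.intro ℓ hd.symm
  have hℓ : ℓ.Prime := hp.out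
  have hle : (𝔞 : FractionalIdeal (quadOrder K d)⁰ K) ≤ upFrac h := fun v hv => by
    have h5 : v * 1 ∈ (𝔞 : FractionalIdeal (quadOrder K d)⁰ K) * upFrac h :=
      FractionalIdeal.mul_mem_mul hv ((mem_upFrac_iff h).mpr (Subalgebra.one_mem _))
    rw [mul_one, h1] at h5
    exact h5
  -- `ℓ 𝒪_c ⊆ 𝔞`
  have hℓ1 : ∀ r ∈ quadOrder K c, (ℓ : K) * r ∈ (𝔞 : FractionalIdeal (quadOrder K d)⁰ K) := by
    intro r hr
    have key : ∀ w ∈ (𝔞 : FractionalIdeal (quadOrder K d)⁰ K) * upFrac h,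
        (ℓ : K) * w ∈ (𝔞 : FractionalIdeal (quadOrder K d)⁰ K) := fun w hw =>
      FractionalIdeal.mul_induction_on hw
        (fun i hi j hj => by
          rw [mul_left_comm, mul_comm]
          exact Submodule.smul_mem _ (⟨(ℓ : K) * j, natCast_mul_mem_quadOrder_of_eq_mul hd
            ((mem_upFrac_iff h).mp hj)⟩ : quadOrder K d) hi)
        (fun x y hx hy => by rw [mul_add]; exact add_mem_fi' hx hy)
    have hr' : r ∈ (𝔞 : FractionalIdeal (quadOrder K d)⁰ K) * upFrac h := by
      rw [h1]; exact (mem_upFrac_iff h).mpr hr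
    exact key r hr'
  -- an element of `𝔞` outside `ℓ 𝒪_c`
  have hu : ∃ u ∈ (𝔞 : FractionalIdeal (quadOrder K d)⁰ K), ∀ r ∈ quadOrder K c, u ≠ (ℓ : K) * r := by
    by_contra! H
    have h1mem : (1 : K) ∈ (𝔞 : FractionalIdeal (quadOrder K d)⁰ K) * upFrac h := by
      rw [h1]; exact (mem_upFrac_iff h).mpr (Subalgebra.one_mem _)
    have hall : ∀ w ∈ (𝔞 : FractionalIdeal (quadOrder K d)⁰ K) * upFrac h,
        ∃ r ∈ quadOrder K c, w = (ℓ : K) * r := fun w hw =>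
      FractionalIdeal.mul_induction_on hw
        (fun i hi j hj => by
          obtain ⟨r, hr, rfl⟩ := H i hi
          exact ⟨r * j, Subalgebra.mul_mem _ hr ((mem_upFrac_iff h).mp hj), by ring⟩)
        (fun x y ⟨r, hr, hx⟩ ⟨r', hr', hy⟩ =>
          ⟨r + r', Subalgebra.add_mem _ hr hr', by rw [hx, hy]; ring⟩)
    obtain ⟨r, hr, hr1⟩ := hall 1 h1mem
    exact natCast_mul_ne_one b hb hℓ.one_lt hr hr1.symm
  obtain ⟨u, hu𝔞, huℓ⟩ := hu
  obtain ⟨X, Y, hY, rfl⟩ := (mem_quadOrder_iff_coords b hb).mp ((mem_upFrac_iff h).mp (hle hu𝔞))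
  -- its norm is prime to `ℓ` (anisotropy + `ℓ ∤ c`)
  have hcop : IsCoprime (X ^ 2 + tConst b * X * Y - mConst b * Y ^ 2) ℓ := by
    rw [isCoprime_comm, Prime.coprime_iff_not_dvd (Nat.prime_iff_prime_int.mp hℓ)]
    intro hdvd
    obtain ⟨⟨X', rfl⟩, hℓY⟩ := hanis X Y hdvd
    have hℓc' : IsCoprime (ℓ : ℤ) (c : ℤ) :=
      Nat.isCoprime_iff_coprime.mpr ((Nat.Prime.coprime_iff_not_dvd hℓ).mpr hℓc)
    have hℓcY : (ℓ : ℤ) * c ∣ Y := IsCoprime.mul_dvd hℓc' hℓY hY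
    obtain ⟨Y', rfl⟩ := hℓcY
    refine huℓ ((X' : K) + ((c * Y' : ℤ) : K) * omega b) (coords_mem_quadOrder b hb (dvd_mul_right _ _)) ?_
    push_cast; ring
  -- `𝔞_u ≤ 𝔞`
  have hY' : (c : ℤ) ∣ -Y := (dvd_neg).mpr hY
  have huO : (X : K) + (Y : K) * omega b ∈ quadOrder K c := coords_mem_quadOrder b hb hY
  have huO' : ((X + tConst b * Y : ℤ) : K) + ((-Y : ℤ) : K) * omega b ∈ quadOrder K c :=
    coords_mem_quadOrder b hb hY'
  have hN := coords_mul_conj b hb X Y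
  have hker_le : (kerUnitOf hd huO huO' hN hcop : FractionalIdeal (quadOrder K d)⁰ K) ≤ 𝔞 := by
    intro v hv
    rw [coe_kerUnitOf] at hv
    obtain ⟨w, hw, r, hr, rfl⟩ := (mem_kerFrac_sub_one_iff h).mp hv
    exact add_mem_fi' (Submodule.smul_mem _ (⟨w, hw⟩ : quadOrder K d) hu𝔞) (hℓ1 r hr)
  -- `𝔠 = 𝔞_u⁻¹ 𝔞` is `𝒪_d`
  have h1𝔠 : (1 : FractionalIdeal (quadOrder K d)⁰ K) ≤
      (((kerUnitOf hd huO huO' hN hcop)⁻¹ * 𝔞 : (FractionalIdeal (quadOrder K d)⁰ K)ˣ) :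
        FractionalIdeal (quadOrder K d)⁰ K) := by
    have := mul_le_mul_right hker_le
      (((kerUnitOf hd huO huO' hN hcop)⁻¹ : (FractionalIdeal (quadOrder K d)⁰ K)ˣ) : FractionalIdeal _ K)
    rwa [Units.inv_mul, ← Units.val_mul] at this
  have h𝔠up : (((kerUnitOf hd huO huO' hN hcop)⁻¹ * 𝔞 : (FractionalIdeal (quadOrder K d)⁰ K)ˣ) :
        FractionalIdeal (quadOrder K d)⁰ K) * upFrac h = upFrac h := by
    rw [Units.val_mul, mul_assoc, h1]
    conv_lhs => rw [← kerUnitOf_mul_upFrac hd huO huO' hN hcop, ← mul_assoc, Units.inv_mul, one_mul]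
  have h𝔠 := coe_units_eq_one_of_one_le hb hd _ h1𝔠 h𝔠up
  refine ⟨X, Y, hY, hcop, ?_⟩
  rw [← coe_kerUnitOf hd huO huO' hN hcop]
  congr 1
  calc 𝔞 = kerUnitOf hd huO huO' hN hcop * ((kerUnitOf hd huO huO' hN hcop)⁻¹ * 𝔞) := by
        rw [mul_inv_cancel_left]
    _ = kerUnitOf hd huO huO' hN hcop := by rw [Units.val_eq_one.mp h𝔠, mul_one]

omit [NeZero c] hp in
/-- **Scaling by a unit mod `ℓ` does not change `𝔞_u`**: if `u' = λu + ℓr` (`λ ∈ ℤ`, `r ∈ 𝒪_c`) then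
`𝔞_{u'} ⊆ 𝔞_u` (`𝔞_v` depends only on the class of `v` in `(𝒪_c/ℓ𝒪_c)^×/(ℤ/ℓ)^×`). [cite: Cox2013, §7.D Thm. 7.24, (7.27)] -/
theorem kerFrac_sub_one_le_of_eq (h : c ∣ d) {u u' r : K} {a : ℤ} (hr : r ∈ quadOrder K c)
    (hu' : u' = (a : K) * u + (ℓ : K) * r) : kerFrac h ℓ (u' - 1) ≤ kerFrac h ℓ (u - 1) := by
  intro x hx
  obtain ⟨w, hw, s, hs, rfl⟩ := (mem_kerFrac_sub_one_iff h).mp hx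
  have e : w * u' + (ℓ : K) * s = (w * a) * u + (ℓ : K) * (w * r + s) := by rw [hu']; ring
  rw [mem_fi', FractionalIdeal.mem_coe, e]
  exact (mem_kerFrac_sub_one_iff h).mpr ⟨w * a, Subalgebra.mul_mem _ hw (Subalgebra.intCast_mem _ a),
    w * r + s, Subalgebra.add_mem _ (Subalgebra.mul_mem _ (quadOrder_le_of_dvd h hw) hr) hs, rfl⟩

omit [NeZero c] hp in
/-- `𝔞_1 = 𝒪_d + ℓ𝒪_c = 𝒪_d` (the trivial class; `ℓ𝒪_c ⊆ 𝒪_{cℓ}`). [cite: Cox2013, §7.A Lemma 7.2, §7.D (7.27)] -/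
theorem kerFrac_one_sub_one_eq_one (hd : d = c * ℓ) :
    kerFrac (Dvd.intro ℓ hd.symm) ℓ ((1 : K) - 1) = 1 := by
  rw [sub_self]
  apply le_antisymm
  · rw [kerFrac, add_zero, FractionalIdeal.spanSingleton_one]
    exact sup_le le_rfl (spanSingleton_mul_upFrac_le_one hd)
  · rw [FractionalIdeal.one_le]
    simpa using one_add_mem_kerFrac (K := K) (Dvd.intro ℓ hd.symm) (p := ℓ) (t := 0)

omit [NumberField K] [NeZero c] [NeZero d] in
/-- **The norms `N(k + cω) = k² + tkc − mc²` are prime to `ℓ`** for `ℓ ∤ c` with anisotropic norm form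
mod `ℓ` (else `ℓ ∣ c`). [cite: Cox2013, §7.D (7.27)] -/
theorem isCoprime_norm_intCast_add_omega (hℓc : ¬ ℓ ∣ c)
    (hanis : ∀ X Y : ℤ, (ℓ : ℤ) ∣ X ^ 2 + tConst b * X * Y - mConst b * Y ^ 2 →
      (ℓ : ℤ) ∣ X ∧ (ℓ : ℤ) ∣ Y) (k : ℤ) :
    IsCoprime (k ^ 2 + tConst b * k * c - mConst b * (c : ℤ) ^ 2) ℓ := by
  rw [isCoprime_comm, Prime.coprime_iff_not_dvd (Nat.prime_iff_prime_int.mp hp.out)]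
  intro hdvd
  exact hℓc (Int.natCast_dvd_natCast.mp (hanis k c hdvd).2)

/-- **The `P¹(𝔽_ℓ)`-family of kernel units `𝔞_{k + cω}`**, `k ∈ ℤ` (together with the trivial class
`𝔞_1 = 𝒪_d` they represent `(𝒪_K/ℓ)^×/(ℤ/ℓ)^× ≅ P¹(𝔽_ℓ)`, `ℓ + 1` classes). Non-`Prop` packaging.
[cite: Cox2013, §7.D Thm. 7.24 (7.25)–(7.27), Cor. 7.28] -/
def kerUnitLine (hd : d = c * ℓ) (hℓc : ¬ ℓ ∣ c)
    (hanis : ∀ X Y : ℤ, (ℓ : ℤ) ∣ X ^ 2 + tConst b * X * Y - mConst b * Y ^ 2 →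
      (ℓ : ℤ) ∣ X ∧ (ℓ : ℤ) ∣ Y) (k : ℤ) : (FractionalIdeal (quadOrder K d)⁰ K)ˣ :=
  kerUnitOf hd (coords_mem_quadOrder b hb (dvd_refl (c : ℤ)))
    (coords_mem_quadOrder b hb ((dvd_neg).mpr (dvd_refl (c : ℤ)))) (coords_mul_conj b hb k c)
    (isCoprime_norm_intCast_add_omega b hℓc hanis k)

omit [NeZero c] in
/-- The underlying ideal of `kerUnitLine k` is `𝔞_{k + cω}`. [cite: Cox2013, §7.D Thm. 7.24, (7.27)] -/
theorem coe_kerUnitLine (hd : d = c * ℓ) (hℓc : ¬ ℓ ∣ c)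
    (hanis : ∀ X Y : ℤ, (ℓ : ℤ) ∣ X ^ 2 + tConst b * X * Y - mConst b * Y ^ 2 →
      (ℓ : ℤ) ∣ X ∧ (ℓ : ℤ) ∣ Y) (k : ℤ) :
    ((kerUnitLine b hb hd hℓc hanis k : (FractionalIdeal (quadOrder K d)⁰ K)ˣ) : FractionalIdeal _ K) =
      kerFrac (Dvd.intro ℓ hd.symm) ℓ (((k : K) + ((c : ℤ) : K) * omega b) - 1) :=
  rfl

/-- `picRes [𝔞_{k + cω}] = 1`. [cite: Cox2013, §7.D Thm. 7.24 (7.25)–(7.27), Cor. 7.28] -/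
theorem picRes_mk_kerUnitLine (hd : d = c * ℓ) (hℓc : ¬ ℓ ∣ c)
    (hanis : ∀ X Y : ℤ, (ℓ : ℤ) ∣ X ^ 2 + tConst b * X * Y - mConst b * Y ^ 2 →
      (ℓ : ℤ) ∣ X ∧ (ℓ : ℤ) ∣ Y) (k : ℤ) :
    picRes K (Dvd.intro ℓ hd.symm) (ClassGroup.mk K (kerUnitLine b hb hd hℓc hanis k)) = 1 :=
  picRes_mk_kerUnitOf hd _ _ _ _

include hb in
/-- **Exhaustion of the kernel by `P¹(𝔽_ℓ)`**: for `ℓ ∤ c` prime with anisotropic norm form mod `ℓ`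
(`ℓ` inert), a class `σ ∈ Pic(𝒪_{cℓ})` with `σ𝒪_c` trivial is `1` or one of `[𝔞_{k + cω}]`, `0 ≤ k < ℓ`:
normalise a representative `𝔞` of `σ` so that `𝔞𝒪_c = 𝒪_c`, write `𝔞 = 𝔞_u` with `u = X + c y ω`
(`exists_coe_eq_kerFrac_sub_one`), and scale `u` by `y⁻¹ (mod ℓ)` if `ℓ ∤ y`, resp. by `X⁻¹ (mod ℓ)`
if `ℓ ∣ y` (then `𝔞_u = 𝔞_1 = 𝒪_d`). So the kernel of `Pic(𝒪_{cℓ}) → Pic(𝒪_c)` has at most `ℓ + 1`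
elements (Cox (7.27): exactly `ℓ + 1` when `𝒪_K^× = {±1}`; distinctness is not proved here).
[cite: Cox2013, §7.D Thm. 7.24 (7.25)–(7.27), Cor. 7.28] -/
theorem eq_one_or_exists_eq_mk_kerUnitLine (hd : d = c * ℓ) (hℓc : ¬ ℓ ∣ c)
    (hanis : ∀ X Y : ℤ, (ℓ : ℤ) ∣ X ^ 2 + tConst b * X * Y - mConst b * Y ^ 2 →
      (ℓ : ℤ) ∣ X ∧ (ℓ : ℤ) ∣ Y)
    {σ : ClassGroup (quadOrder K d)} (hσ : picRes K (Dvd.intro ℓ hd.symm) σ = 1) :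
    σ = 1 ∨ ∃ k : ℕ, k < ℓ ∧ σ = ClassGroup.mk K (kerUnitLine b hb hd hℓc hanis k) := by
  have h : c ∣ d := Dvd.intro ℓ hd.symm
  have hℓ : ℓ.Prime := hp.out
  have hℓp : Prime (ℓ : ℤ) := Nat.prime_iff_prime_int.mp hℓ
  revert hσ
  refine ClassGroup.induction (K := K) (fun 𝔞 => ?_) σ
  intro hσ
  rw [picRes_mk, ClassGroup.mk_eq_one_iff, coe_extUnits, FractionalIdeal.isPrincipal_iff] at hσ
  obtain ⟨x, hx⟩ := hσ
  have hx0 : x ≠ 0 := by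
    intro h0
    rw [h0, FractionalIdeal.spanSingleton_zero] at hx
    exact (extUnits K h 𝔞).ne_zero hx
  -- normalise the representative: `𝔞' = x⁻¹ 𝔞` has `𝔞'𝒪_c = 𝒪_c`
  obtain ⟨𝔞', h𝔞'⟩ : ∃ 𝔞' : (FractionalIdeal (quadOrder K d)⁰ K)ˣ,
      𝔞' = toPrincipalIdeal (quadOrder K d) K (Units.mk0 x hx0)⁻¹ * 𝔞 := ⟨_, rfl⟩
  have hmk : ClassGroup.mk K 𝔞' = ClassGroup.mk K 𝔞 := by
    rw [h𝔞', map_mul, mk_toPrincipalIdeal, one_mul]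
  have hext : extFrac K h (𝔞' : FractionalIdeal (quadOrder K d)⁰ K) = 1 := by
    rw [h𝔞', Units.val_mul, RingHom.map_mul, coe_toPrincipalIdeal, extFrac_spanSingleton, hx,
      Units.val_inv_eq_inv_val, Units.val_mk0, FractionalIdeal.spanSingleton_mul_spanSingleton,
      inv_mul_cancel₀ hx0, FractionalIdeal.spanSingleton_one]
  obtain ⟨X, Y, ⟨y, rfl⟩, hcop, h𝔞'eq⟩ :=
    exists_coe_eq_kerFrac_sub_one b hb hd hℓc hanis 𝔞' ((extFrac_eq_one_iff h _).mp hext)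
  rw [← hmk]
  by_cases hℓy : (ℓ : ℤ) ∣ y
  · -- `ℓ ∣ y`: `ℓ ∤ X`, and `𝔞_u = 𝔞_1 = 𝒪_d`
    left
    obtain ⟨y', rfl⟩ := hℓy
    have hX : ¬ (ℓ : ℤ) ∣ X := fun hX => by
      refine (Prime.coprime_iff_not_dvd hℓp).mp (isCoprime_comm.mp hcop) ?_
      exact dvd_sub (dvd_add (dvd_pow hX two_ne_zero) (Dvd.intro (tConst b * X * c * y') (by ring)))
        (Dvd.intro (mConst b * c ^ 2 * ℓ * y' ^ 2) (by ring))
    obtain ⟨q, j, hqX⟩ := (Prime.coprime_iff_not_dvd hℓp).mpr hX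
    -- `1 = j u + ℓ(q − c j y' ω)` and `u = X · 1 + ℓ (c y' ω)`
    have e1 : (1 : K) = (j : K) * ((X : K) + ((c * (ℓ * y') : ℤ) : K) * omega b) +
        (ℓ : K) * ((q : K) + ((-(c * (j * y')) : ℤ) : K) * omega b) := by
      have h1' := congrArg (fun z : ℤ => (z : K)) hqX
      push_cast at h1' ⊢
      linear_combination -h1'
    have e2 : (X : K) + ((c * (ℓ * y') : ℤ) : K) * omega b =
        (X : K) * 1 + (ℓ : K) * (((c * y' : ℤ) : K) * omega b) := by
      push_cast; ring
    rw [ClassGroup.mk_eq_one_iff, FractionalIdeal.isPrincipal_iff]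
    refine ⟨1, ?_⟩
    rw [FractionalIdeal.spanSingleton_one, h𝔞'eq, ← kerFrac_one_sub_one_eq_one (K := K) hd]
    exact le_antisymm
      (kerFrac_sub_one_le_of_eq h (intCast_mul_omega_mem b hb (dvd_mul_right _ _)) e2)
      (kerFrac_sub_one_le_of_eq h (coords_mem_quadOrder b hb
        (Y := -(c * (j * y'))) ((dvd_neg).mpr (dvd_mul_right _ _))) e1)
  · -- `ℓ ∤ y`: scale by `j = y⁻¹ (mod ℓ)`, `k = jX mod ℓ`
    right
    obtain ⟨q, j, hqy⟩ := (Prime.coprime_iff_not_dvd hℓp).mpr hℓy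
    have hℓ0 : (0 : ℤ) < ℓ := by exact_mod_cast hℓ.pos
    refine ⟨((j * X) % ℓ).toNat, ?_, ?_⟩
    · have h0 := Int.emod_nonneg (j * X) hℓ0.ne'
      have h1 := Int.emod_lt_of_pos (j * X) hℓ0
      omega
    · have hk' : (((j * X) % ℓ).toNat : ℤ) = (j * X) % ℓ :=
        Int.toNat_of_nonneg (Int.emod_nonneg _ hℓ0.ne')
      obtain ⟨i, hi⟩ : (ℓ : ℤ) ∣ j * X - (((j * X) % ℓ).toNat : ℤ) := by
        rw [hk']; exact (Int.mod_modEq (j * X) (ℓ : ℤ)).dvd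
      -- `k + cω = j u + ℓ(−i + c q ω)` and `u = y (k + cω) + ℓ (X q + y i)`
      have e1 : (((((j * X) % ℓ).toNat : ℤ) : ℤ) : K) + ((c : ℤ) : K) * omega b =
          (j : K) * ((X : K) + ((c * y : ℤ) : K) * omega b) +
            (ℓ : K) * (((-i : ℤ) : K) + ((c * q : ℤ) : K) * omega b) := by
        have h1' := congrArg (fun z : ℤ => (z : K)) hqy
        have h2' := congrArg (fun z : ℤ => (z : K)) hi
        push_cast at h1' h2' ⊢
        linear_combination -h2' - ((c : K) * omega b) * h1'
      have e2 : (X : K) + ((c * y : ℤ) : K) * omega b =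
          (y : K) * ((((((j * X) % ℓ).toNat : ℤ) : ℤ) : K) + ((c : ℤ) : K) * omega b) +
            (ℓ : K) * ((((X * q) + y * i : ℤ) : K) + ((0 : ℤ) : K) * omega b) := by
        have h1' := congrArg (fun z : ℤ => (z : K)) hqy
        have h2' := congrArg (fun z : ℤ => (z : K)) hi
        push_cast at h1' h2' ⊢
        linear_combination -(X : K) * h1' + (y : K) * h2'
      congr 1
      ext1
      rw [h𝔞'eq, coe_kerUnitLine]
      refine le_antisymm ?_ ?_
      · have := kerFrac_sub_one_le_of_eq h (ℓ := ℓ) (coords_mem_quadOrder b hb (X := X * q + y * i)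
          (Y := 0) (dvd_zero _)) e2
        push_cast at this ⊢
        exact this
      · have := kerFrac_sub_one_le_of_eq h (ℓ := ℓ) (coords_mem_quadOrder b hb (X := -i)
          (Y := c * q) (dvd_mul_right _ _)) e1
        push_cast at this ⊢
        exact this

end Exhaust

/-! ### §4 `ℓ` inert ⇒ anisotropy; distinctness of the `ℓ + 1` classes; the fibres -/

section Distinct

variable {c d : ℕ} [NumberField K] [NeZero c] [NeZero d] (b : Basis (Fin 2) ℤ (𝓞 K)) (hb : b 0 = 1)
  {ℓ : ℕ} [hp : Fact ℓ.Prime]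

omit [NumberField K] [NeZero c] [NeZero d] hp in
include hb in
/-- Coordinates of `X + Y b₁` in the basis `(1, b₁)`. [folklore] -/
private theorem repr_coords (X Y : ℤ) (i : Fin 2) :
    b.repr ((X : 𝓞 K) + (Y : 𝓞 K) * b 1) i = if i = 0 then X else Y := by
  have e : (X : 𝓞 K) + (Y : 𝓞 K) * b 1 = X • b 0 + Y • b 1 := by
    rw [hb, zsmul_eq_mul, zsmul_eq_mul, mul_one]
  rw [e, map_add, map_zsmul, map_zsmul, b.repr_self, b.repr_self]
  fin_cases i <;> simp

omit [NumberField K] [NeZero c] [NeZero d] hp in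
include hb in
/-- **`ℓ` inert ⇒ the norm form is anisotropic mod `ℓ`**: if `ℓ𝓞_K` is a prime ideal and
`ℓ ∣ X² + tXY − mY² = (X + Yω)(X + tY − Yω)`, then `ℓ𝓞_K` contains `X + Yω` or its conjugate, so
`ℓ ∣ X` and `ℓ ∣ Y` (coordinates in the basis `(1, ω)`). [cite: Cox2013, §7.D (7.27) ((𝒪_K/ℓ)^× for ℓ inert), §5.B Prop. 5.16] -/
theorem anisotropic_of_span_natCast_isPrime (hℓP : (Ideal.span {(ℓ : 𝓞 K)}).IsPrime) (X Y : ℤ)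
    (hdvd : (ℓ : ℤ) ∣ X ^ 2 + tConst b * X * Y - mConst b * Y ^ 2) : (ℓ : ℤ) ∣ X ∧ (ℓ : ℤ) ∣ Y := by
  have hω : b 1 * b 1 = (mConst b : 𝓞 K) + (tConst b : 𝓞 K) * b 1 := basis_one_mul_self_eq b hb
  have e : ((X : 𝓞 K) + (Y : 𝓞 K) * b 1) * (((X + tConst b * Y : ℤ) : 𝓞 K) + ((-Y : ℤ) : 𝓞 K) * b 1) =
      ((X ^ 2 + tConst b * X * Y - mConst b * Y ^ 2 : ℤ) : 𝓞 K) := by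
    push_cast
    linear_combination (-((Y : 𝓞 K) ^ 2)) * hω
  obtain ⟨n, hn⟩ := hdvd
  have hmem : ((X : 𝓞 K) + (Y : 𝓞 K) * b 1) *
      (((X + tConst b * Y : ℤ) : 𝓞 K) + ((-Y : ℤ) : 𝓞 K) * b 1) ∈ Ideal.span {(ℓ : 𝓞 K)} := by
    rw [e, hn, Ideal.mem_span_singleton]
    exact ⟨n, by push_cast; ring⟩
  -- membership of `U + V b₁` in `ℓ𝓞_K` forces `ℓ ∣ U`, `ℓ ∣ V`
  have key : ∀ U V : ℤ, (U : 𝓞 K) + (V : 𝓞 K) * b 1 ∈ Ideal.span {(ℓ : 𝓞 K)} →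
      (ℓ : ℤ) ∣ U ∧ (ℓ : ℤ) ∣ V := by
    intro U V hUV
    obtain ⟨w, hw⟩ := Ideal.mem_span_singleton'.mp hUV
    have hrepr : ∀ i : Fin 2, (if i = 0 then U else V) = (ℓ : ℤ) * b.repr w i := fun i => by
      rw [← repr_coords b hb U V i, ← hw, mul_comm, ← nsmul_eq_mul, map_nsmul, Finsupp.smul_apply,
        nsmul_eq_mul]
    exact ⟨⟨b.repr w 0, by simpa using hrepr 0⟩, ⟨b.repr w 1, by simpa using hrepr 1⟩⟩
  rcases hℓP.mem_or_mem hmem with h1 | h1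
  · exact key X Y h1
  · obtain ⟨hX, hY⟩ := key (X + tConst b * Y) (-Y) h1
    have hY' : (ℓ : ℤ) ∣ Y := (dvd_neg).mp hY
    exact ⟨by simpa using dvd_sub hX (hY'.mul_left (tConst b)), hY'⟩

omit hp in
/-- **Equal kernel classes force membership**: if `[𝔞_{v₁}] = [𝔞_{v₂}]` for two kernel units and the
units of `𝒪_c` are `±1`, then `v₂ ∈ 𝔞_{v₁}` (`𝔞_{v₂} = x𝔞_{v₁}` with `x𝒪_c = 𝒪_c`, so `x = ±1`). [cite: Cox2013, §7.D Thm. 7.24 (7.25)–(7.27), Cor. 7.28] -/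
theorem mem_of_mk_kerUnitOf_eq (hunits : ∀ u : (quadOrder K c)ˣ, ((u : quadOrder K c) : K) = 1 ∨
      ((u : quadOrder K c) : K) = -1) (hd : d = c * ℓ)
    {v₁ v₁' : K} (hv₁ : v₁ ∈ quadOrder K c) (hv₁' : v₁' ∈ quadOrder K c) {n₁ : ℤ}
    (hvv₁ : v₁ * v₁' = n₁) (hn₁ : IsCoprime n₁ ℓ)
    {v₂ v₂' : K} (hv₂ : v₂ ∈ quadOrder K c) (hv₂' : v₂' ∈ quadOrder K c) {n₂ : ℤ}
    (hvv₂ : v₂ * v₂' = n₂) (hn₂ : IsCoprime n₂ ℓ)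
    (he : ClassGroup.mk K (kerUnitOf hd hv₁ hv₁' hvv₁ hn₁) =
      ClassGroup.mk K (kerUnitOf hd hv₂ hv₂' hvv₂ hn₂)) :
    v₂ ∈ kerFrac (Dvd.intro ℓ hd.symm) ℓ (v₁ - 1) := by
  have h : c ∣ d := Dvd.intro ℓ hd.symm
  obtain ⟨x, hx⟩ := mk_eq_mk_iff.mp he
  have hx1 : FractionalIdeal.spanSingleton (quadOrder K c)⁰ (x : K) = 1 := by
    have h2 := congrArg (extUnits K h) hx
    rw [map_mul, extUnits_kerUnitOf, extUnits_kerUnitOf, one_mul] at h2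
    have h3 := congrArg Units.val h2
    rwa [coe_extUnits, coe_toPrincipalIdeal, extFrac_spanSingleton, Units.val_one] at h3
  have hxO : (x : K) ∈ quadOrder K c := by
    have h2 : (x : K) ∈ FractionalIdeal.spanSingleton (quadOrder K c)⁰ (x : K) :=
      FractionalIdeal.mem_spanSingleton_self _ _
    rw [hx1] at h2
    obtain ⟨v, hv⟩ := (FractionalIdeal.mem_one_iff _).mp h2
    rw [← hv]; exact v.2
  have hxinvO : ((x⁻¹ : Kˣ) : K) ∈ quadOrder K c := by
    have h2 : (1 : K) ∈ FractionalIdeal.spanSingleton (quadOrder K c)⁰ (x : K) := by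
      rw [hx1]; exact FractionalIdeal.one_mem_one _
    obtain ⟨v, hv⟩ := (FractionalIdeal.mem_spanSingleton _).mp h2
    have h3 : (v : K) = ((x⁻¹ : Kˣ) : K) := by
      rw [Algebra.smul_def] at hv
      rw [Units.val_inv_eq_inv_val]
      exact eq_inv_of_mul_eq_one_left hv
    rw [← h3]; exact v.2
  let xu : (quadOrder K c)ˣ :=
    ⟨⟨x, hxO⟩, ⟨((x⁻¹ : Kˣ) : K), hxinvO⟩, Subtype.ext x.mul_inv, Subtype.ext x.inv_mul⟩
  have hxpm : (x : K) = 1 ∨ (x : K) = -1 := hunits xu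
  have h0 : v₂ ∈ (kerUnitOf hd hv₂ hv₂' hvv₂ hn₂ : FractionalIdeal (quadOrder K d)⁰ K) :=
    self_mem_kerFrac_sub_one h
  rw [← hx, Units.val_mul, coe_toPrincipalIdeal, mul_comm] at h0
  obtain ⟨y', hy', hyeq⟩ := FractionalIdeal.mem_singleton_mul.mp h0
  rw [coe_kerUnitOf] at hy'
  rcases hxpm with h1 | h1
  · rw [hyeq, h1, one_mul]; exact hy'
  · rw [hyeq, h1, neg_one_mul]; exact Submodule.neg_mem _ hy'

omit hp in
include hb in
/-- **Membership `k' + cω ∈ 𝔞_{k + cω}` forces `k ≡ k' (mod ℓ)`** (compare coordinates: with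
`k' + cω = (U + Vω)(k + cω) + ℓ(R + Sω)`, `cℓ ∣ V`, `c ∣ S`, the `ω`-coordinate gives `U ≡ 1`, the
constant one `k' ≡ Uk ≡ k (mod ℓ)`). [cite: Cox2013, §7.D Thm. 7.24, (7.27)] -/
theorem dvd_sub_of_mem_kerFrac_line (hd : d = c * ℓ) {k k' : ℤ}
    (hmem : ((k' : ℤ) : K) + ((c : ℤ) : K) * omega b ∈
      kerFrac (Dvd.intro ℓ hd.symm) ℓ ((((k : ℤ) : K) + ((c : ℤ) : K) * omega b) - 1)) :
    (ℓ : ℤ) ∣ k' - k := by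
  have h : c ∣ d := Dvd.intro ℓ hd.symm
  obtain ⟨u, hu, r, hr, hdec⟩ := (mem_kerFrac_sub_one_iff h).mp hmem
  obtain ⟨U, V, hV, rfl⟩ := (mem_quadOrder_iff_coords b hb).mp hu
  obtain ⟨R, S, hS, rfl⟩ := (mem_quadOrder_iff_coords b hb).mp hr
  have hω := omega_sq b hb
  have hfinal : ((k' : ℤ) : K) + ((c : ℤ) : K) * omega b =
      ((U * k + V * c * mConst b + ℓ * R : ℤ) : K) +
        ((U * c + V * k + V * c * tConst b + ℓ * S : ℤ) : K) * omega b := by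
    push_cast at hdec ⊢
    linear_combination hdec + ((V : K) * (c : K)) * hω
  obtain ⟨h1, h2⟩ := coords_unique b hb hfinal
  obtain ⟨v, rfl⟩ := hV
  obtain ⟨s, rfl⟩ := hS
  have hc0 : (c : ℤ) ≠ 0 := by exact_mod_cast NeZero.ne c
  subst hd
  push_cast at h1 h2
  have h2' : 1 = U + ℓ * (v * k + v * c * tConst b + s) := by
    apply mul_left_cancel₀ hc0
    linear_combination h2
  exact ⟨-(k * (v * k + v * c * tConst b + s)) + c * v * c * mConst b + R, by linear_combination h1 - k * h2'⟩

include hb in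
/-- `1 ∉ 𝔞_{k + cω}` (the `ω`-coordinate gives `U ≡ 0`, the constant one `1 ≡ Uk ≡ 0 (mod ℓ)`). [cite: Cox2013, §7.D Thm. 7.24, (7.27)] -/
theorem one_not_mem_kerFrac_line (hd : d = c * ℓ) (k : ℤ) :
    (1 : K) ∉ kerFrac (Dvd.intro ℓ hd.symm) ℓ ((((k : ℤ) : K) + ((c : ℤ) : K) * omega b) - 1) := by
  have h : c ∣ d := Dvd.intro ℓ hd.symm
  intro hmem
  obtain ⟨u, hu, r, hr, hdec⟩ := (mem_kerFrac_sub_one_iff h).mp hmem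
  obtain ⟨U, V, hV, rfl⟩ := (mem_quadOrder_iff_coords b hb).mp hu
  obtain ⟨R, S, hS, rfl⟩ := (mem_quadOrder_iff_coords b hb).mp hr
  have hω := omega_sq b hb
  have hfinal : ((1 : ℤ) : K) + ((0 : ℤ) : K) * omega b =
      ((U * k + V * c * mConst b + ℓ * R : ℤ) : K) +
        ((U * c + V * k + V * c * tConst b + ℓ * S : ℤ) : K) * omega b := by
    push_cast at hdec ⊢
    linear_combination hdec + ((V : K) * (c : K)) * hω
  obtain ⟨h1, h2⟩ := coords_unique b hb hfinal
  obtain ⟨v, rfl⟩ := hV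
  obtain ⟨s, rfl⟩ := hS
  have hc0 : (c : ℤ) ≠ 0 := by exact_mod_cast NeZero.ne c
  subst hd
  push_cast at h1 h2
  have h2' : 0 = U + ℓ * (v * k + v * c * tConst b + s) := by
    apply mul_left_cancel₀ hc0
    linear_combination h2
  have : (ℓ : ℤ) ∣ 1 := ⟨-(k * (v * k + v * c * tConst b + s)) + c * v * c * mConst b + R,
    by linear_combination h1 - k * h2'⟩
  exact hp.out.one_lt.ne' (by exact_mod_cast Int.eq_one_of_dvd_one (Int.natCast_nonneg ℓ) this)

include hb in
/-- **No repetitions**: `[𝔞_{k + cω}] = [𝔞_{k' + cω}]` forces `ℓ ∣ k' − k` (units of `𝒪_c` are `±1`).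
[cite: Cox2013, §7.D Thm. 7.24 (7.25)–(7.27), Cor. 7.28] -/
theorem dvd_sub_of_mk_kerUnitLine_eq (hunits : ∀ u : (quadOrder K c)ˣ, ((u : quadOrder K c) : K) = 1 ∨
      ((u : quadOrder K c) : K) = -1) (hd : d = c * ℓ) (hℓc : ¬ ℓ ∣ c)
    (hanis : ∀ X Y : ℤ, (ℓ : ℤ) ∣ X ^ 2 + tConst b * X * Y - mConst b * Y ^ 2 →
      (ℓ : ℤ) ∣ X ∧ (ℓ : ℤ) ∣ Y) {k k' : ℤ}
    (he : ClassGroup.mk K (kerUnitLine b hb hd hℓc hanis k) =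
      ClassGroup.mk K (kerUnitLine b hb hd hℓc hanis k')) : (ℓ : ℤ) ∣ k' - k :=
  dvd_sub_of_mem_kerFrac_line b hb hd (mem_of_mk_kerUnitOf_eq hunits hd _ _ _ _ _ _ _ _ he)

include hb in
/-- **`[𝔞_{k + cω}] ≠ 1`** (units of `𝒪_c` are `±1`). [cite: Cox2013, §7.D Thm. 7.24 (7.25)–(7.27), Cor. 7.28] -/
theorem mk_kerUnitLine_ne_one (hunits : ∀ u : (quadOrder K c)ˣ, ((u : quadOrder K c) : K) = 1 ∨
      ((u : quadOrder K c) : K) = -1) (hd : d = c * ℓ) (hℓc : ¬ ℓ ∣ c)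
    (hanis : ∀ X Y : ℤ, (ℓ : ℤ) ∣ X ^ 2 + tConst b * X * Y - mConst b * Y ^ 2 →
      (ℓ : ℤ) ∣ X ∧ (ℓ : ℤ) ∣ Y) (k : ℤ) :
    ClassGroup.mk K (kerUnitLine b hb hd hℓc hanis k) ≠ 1 := by
  intro he
  -- `1 = [𝔞_1]`, `𝔞_1 = kerUnitOf` with `v = v' = 1`
  have h1u : ClassGroup.mk K (kerUnitOf hd (v := (1 : K)) (v' := 1) (n := 1) (Subalgebra.one_mem _)
      (Subalgebra.one_mem _) (by simp) (isCoprime_one_left)) = 1 := by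
    rw [ClassGroup.mk_eq_one_iff, FractionalIdeal.isPrincipal_iff]
    exact ⟨1, by rw [FractionalIdeal.spanSingleton_one, coe_kerUnitOf, kerFrac_one_sub_one_eq_one hd]⟩
  rw [← h1u] at he
  exact one_not_mem_kerFrac_line b hb hd k (mem_of_mk_kerUnitOf_eq hunits hd _ _ _ _ _ _ _ _ he)

include hb in
/-- The classes `[𝔞_{k + cω}]`, `0 ≤ k < ℓ`, are pairwise distinct. [cite: Cox2013, §7.D Thm. 7.24 (7.25)–(7.27), Cor. 7.28] -/
theorem mk_kerUnitLine_injOn (hunits : ∀ u : (quadOrder K c)ˣ, ((u : quadOrder K c) : K) = 1 ∨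
      ((u : quadOrder K c) : K) = -1) (hd : d = c * ℓ) (hℓc : ¬ ℓ ∣ c)
    (hanis : ∀ X Y : ℤ, (ℓ : ℤ) ∣ X ^ 2 + tConst b * X * Y - mConst b * Y ^ 2 →
      (ℓ : ℤ) ∣ X ∧ (ℓ : ℤ) ∣ Y) :
    Set.InjOn (fun k : ℕ => ClassGroup.mk K (kerUnitLine b hb hd hℓc hanis k)) (Finset.range ℓ : Set ℕ) := by
  intro k hk k' hk' he
  have hk : k < ℓ := by simpa using hk
  have hk' : k' < ℓ := by simpa using hk'
  have hdvd := dvd_sub_of_mk_kerUnitLine_eq b hb hunits hd hℓc hanis he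
  have : (k : ℤ) = k' := by
    rcases hdvd with ⟨j, hj⟩
    have hj0 : j = 0 := by
      rcases lt_trichotomy j 0 with hj' | hj' | hj'
      · nlinarith
      · exact hj'
      · nlinarith
    rw [hj0, mul_zero, sub_eq_zero] at hj
    exact hj.symm
  exact_mod_cast this

include hb in
/-- **The kernel of `Pic(𝒪_{cℓ}) → Pic(𝒪_c)` is `{1} ∪ {[𝔞_{k + cω}] : 0 ≤ k < ℓ}`** for a prime `ℓ ∤ c`
with anisotropic norm form mod `ℓ` (`ℓ` inert). [cite: Cox2013, §7.D Thm. 7.24 (7.25)–(7.27), Cor. 7.28] -/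
theorem filter_picRes_eq_one_eq [Fintype (ClassGroup (quadOrder K d))]
    [DecidableEq (ClassGroup (quadOrder K c))] [DecidableEq (ClassGroup (quadOrder K d))]
    (hd : d = c * ℓ) (hℓc : ¬ ℓ ∣ c)
    (hanis : ∀ X Y : ℤ, (ℓ : ℤ) ∣ X ^ 2 + tConst b * X * Y - mConst b * Y ^ 2 →
      (ℓ : ℤ) ∣ X ∧ (ℓ : ℤ) ∣ Y) :
    (Finset.univ.filter fun σ => picRes K (Dvd.intro ℓ hd.symm) σ = 1) =
      insert 1 ((Finset.range ℓ).image fun k : ℕ => ClassGroup.mk K (kerUnitLine b hb hd hℓc hanis k)) := by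
  ext σ
  simp only [Finset.mem_filter, Finset.mem_univ, true_and, Finset.mem_insert, Finset.mem_image,
    Finset.mem_range]
  constructor
  · intro hσ
    rcases eq_one_or_exists_eq_mk_kerUnitLine b hb hd hℓc hanis hσ with h1 | ⟨k, hk, hkσ⟩
    · exact Or.inl h1
    · exact Or.inr ⟨k, hk, hkσ.symm⟩
  · rintro (rfl | ⟨k, -, rfl⟩)
    · exact map_one _
    · exact picRes_mk_kerUnitLine b hb hd hℓc hanis k

include hb in
/-- **The kernel has exactly `ℓ + 1` elements** when moreover `𝒪_c^× = {±1}` (e.g. `K` imaginary quadratic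
and `c ≥ 2`, tree `coe_units_quadOrder_eq_one_or_eq_neg_one`; Cox (7.27): `#ker = (ℓ + 1)/[𝒪_K^× ∩ … ]`).
[cite: Cox2013, §7.D Thm. 7.24 (7.25)–(7.27), Cor. 7.28] -/
theorem card_filter_picRes_eq_one [Fintype (ClassGroup (quadOrder K d))]
    [DecidableEq (ClassGroup (quadOrder K c))]
    (hunits : ∀ u : (quadOrder K c)ˣ, ((u : quadOrder K c) : K) = 1 ∨ ((u : quadOrder K c) : K) = -1)
    (hd : d = c * ℓ) (hℓc : ¬ ℓ ∣ c)
    (hanis : ∀ X Y : ℤ, (ℓ : ℤ) ∣ X ^ 2 + tConst b * X * Y - mConst b * Y ^ 2 →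
      (ℓ : ℤ) ∣ X ∧ (ℓ : ℤ) ∣ Y) :
    (Finset.univ.filter fun σ => picRes K (Dvd.intro ℓ hd.symm) σ = 1).card = ℓ + 1 := by
  classical
  rw [filter_picRes_eq_one_eq b hb hd hℓc hanis, Finset.card_insert_of_notMem, Finset.card_image_of_injOn
    (mk_kerUnitLine_injOn b hb hunits hd hℓc hanis), Finset.card_range]
  simp only [Finset.mem_image, Finset.mem_range, not_exists, not_and]
  exact fun k _ hk => mk_kerUnitLine_ne_one b hb hunits hd hℓc hanis k hk

include hb in
/-- **Imaginary quadratic `K`, `c ≥ 2`, `ℓ ∤ c` inert**: the kernel of `Pic(𝒪_{cℓ}) → Pic(𝒪_c)` has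
`ℓ + 1` elements. [cite: Cox2013, §7.D Thm. 7.24 (7.25)–(7.27), Cor. 7.28] -/
theorem card_filter_picRes_eq_one_of_isPrime [Fintype (ClassGroup (quadOrder K d))]
    [DecidableEq (ClassGroup (quadOrder K c))] (hK : IsImaginaryQuadratic K) (hc : 2 ≤ c)
    (hd : d = c * ℓ) (hℓc : ¬ ℓ ∣ c) (hℓP : (Ideal.span {(ℓ : 𝓞 K)}).IsPrime) :
    (Finset.univ.filter fun σ => picRes K (Dvd.intro ℓ hd.symm) σ = 1).card = ℓ + 1 :=
  card_filter_picRes_eq_one b hb (coe_units_quadOrder_eq_one_or_eq_neg_one hK hc) hd hℓc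
    (anisotropic_of_span_natCast_isPrime b hb hℓP)

end Distinct

/-! ### §5 Multiplicativity `𝔞_u 𝔞_v = 𝔞_{uv}` and congruence-invariance (towards `(𝒪_K/ℓ)^× → ker`) -/

section Hom

variable {c d : ℕ} [NumberField K] [NeZero d] {ℓ : ℕ}

/-- **`𝔞_{u'} = 𝔞_u` when `u' ≡ u (mod ℓ𝒪_c)`**: the kernel ideal only depends on `u mod ℓ𝒪_c`. [cite: Cox2013, §7.D Thm. 7.24, (7.27)] -/
theorem kerFrac_sub_one_eq_of_sub_eq (h : c ∣ d) {u u' r : K} (hr : r ∈ quadOrder K c)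
    (hu' : u' - u = (ℓ : K) * r) : kerFrac h ℓ (u' - 1) = kerFrac h ℓ (u - 1) :=
  le_antisymm
    (kerFrac_sub_one_le_of_eq h (a := 1) hr (by rw [Int.cast_one, one_mul, ← hu']; ring))
    (kerFrac_sub_one_le_of_eq h (a := 1) (Subalgebra.neg_mem _ hr)
      (by rw [Int.cast_one, one_mul, mul_neg, ← hu']; ring))

/-- **Multiplicativity `𝔞_u · 𝔞_v = 𝔞_{uv}`** for `u, v ∈ 𝒪_c` with `N(u) = u u'` (`u' ∈ 𝒪_c`) prime to `ℓ`
(`d = cℓ`): `⊆` from `(wu + ℓr)(w'v + ℓr') = ww'·uv + ℓ(…)` with `ℓ𝒪_c ⊆ 𝒪_d`... precisely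
`(wu + ℓr)(w'v + ℓr') = (ww')(uv) + ℓ(wur' + w'vr + ℓrr')`; `⊇`: `uv = u·v` and, with `an + bℓ = 1`
(`n = N(u)`), `ℓs = a(u)(ℓ u' s)·… ` — we use `ℓ s = (a u)(ℓ u' s) + (ℓ)(b ℓ s)`-free form
`ℓ s = u·(ℓ(a u' s)) + ℓ·(ℓ (b s))`, both products in `𝔞_u 𝔞_v` (as `ℓ x ∈ 𝔞_v` for `x ∈ 𝒪_c`). So
`u ↦ 𝔞_u` is a monoid map on `{u ∈ 𝒪_c : (N(u), ℓ) = 1}` — the ideal-theoretic form of Cox's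
homomorphism `(𝒪_K/ℓ)^× → ker(Pic(𝒪_{cℓ}) → Pic(𝒪_c))`. [cite: Cox2013, §7.D Thm. 7.24 (7.25)–(7.27), Cor. 7.28] -/
theorem kerFrac_sub_one_mul_kerFrac_sub_one_eq (hd : d = c * ℓ) {u u' v : K} (hu : u ∈ quadOrder K c)
    (hu' : u' ∈ quadOrder K c) (hv : v ∈ quadOrder K c) {n : ℤ} (huu' : u * u' = n)
    (hn : IsCoprime n ℓ) :
    kerFrac (Dvd.intro ℓ hd.symm) ℓ (u - 1) * kerFrac (Dvd.intro ℓ hd.symm) ℓ (v - 1) =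
      kerFrac (Dvd.intro ℓ hd.symm) ℓ (u * v - 1) := by
  have h : c ∣ d := Dvd.intro ℓ hd.symm
  apply le_antisymm
  · rw [FractionalIdeal.mul_le]
    intro x hx y hy
    obtain ⟨w, hw, r, hr, rfl⟩ := (mem_kerFrac_sub_one_iff h).mp hx
    obtain ⟨w', hw', r', hr', rfl⟩ := (mem_kerFrac_sub_one_iff h).mp hy
    have e : (w * u + (ℓ : K) * r) * (w' * v + (ℓ : K) * r') =
        (w * w') * (u * v) + (ℓ : K) * (w * u * r' + w' * v * r + (ℓ : K) * (r * r')) := by ring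
    rw [e]
    have hw₁ := quadOrder_le_of_dvd h hw
    have hw'₁ := quadOrder_le_of_dvd h hw'
    exact (mem_kerFrac_sub_one_iff h).mpr ⟨w * w', Subalgebra.mul_mem _ hw hw', _,
      Subalgebra.add_mem _ (Subalgebra.add_mem _
        (Subalgebra.mul_mem _ (Subalgebra.mul_mem _ hw₁ hu) hr')
        (Subalgebra.mul_mem _ (Subalgebra.mul_mem _ hw'₁ hv) hr))
        (Subalgebra.mul_mem _ (Subalgebra.natCast_mem _ ℓ) (Subalgebra.mul_mem _ hr hr')), rfl⟩
  · intro x hx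
    obtain ⟨w, hw, s, hs, rfl⟩ := (mem_kerFrac_sub_one_iff h).mp hx
    obtain ⟨a, b, hab⟩ := hn
    have hab' : (a : K) * n + b * ℓ = 1 := by exact_mod_cast congrArg (fun z : ℤ => (z : K)) hab
    -- `w(uv) = (wu)·v`, `ℓ s = u·(ℓ(a u' s)) + ℓ·(ℓ(b s))`
    have e : w * (u * v) + (ℓ : K) * s =
        (w * u) * v + (u * ((ℓ : K) * ((a : K) * u' * s)) + (ℓ : K) * ((ℓ : K) * ((b : K) * s))) := by
      linear_combination (-(ℓ : K) * s) * hab' + (-(ℓ : K) * (a : K) * s) * huu'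
    have hℓmem : (ℓ : K) ∈ kerFrac h ℓ (u - 1) := by
      simpa using natCast_mul_mem_kerFrac_sub_one (K := K) h (ℓ := ℓ) (v := u) (Subalgebra.one_mem _)
    rw [mem_fi', FractionalIdeal.mem_coe, e]
    refine add_mem_fi' (FractionalIdeal.mul_mem_mul ((mem_kerFrac_sub_one_iff h).mpr
        ⟨w, hw, 0, Subalgebra.zero_mem _, by simp⟩) (self_mem_kerFrac_sub_one h))
      (add_mem_fi'
        (FractionalIdeal.mul_mem_mul (self_mem_kerFrac_sub_one h) (natCast_mul_mem_kerFrac_sub_one h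
          (Subalgebra.mul_mem _ (Subalgebra.mul_mem _ (Subalgebra.intCast_mem _ a) hu') hs)))
        (FractionalIdeal.mul_mem_mul hℓmem
          (natCast_mul_mem_kerFrac_sub_one h (Subalgebra.mul_mem _ (Subalgebra.intCast_mem _ b) hs))))

end Hom

/-! ### §6 `𝒪_c/ℓ𝒪_c = 𝓞_K/ℓ𝓞_K` for `ℓ ∤ c`: lifting residues into `𝒪_c`, and `𝒪_c ∩ ℓ𝓞_K = ℓ𝒪_c` -/

section Residues

variable {c : ℕ} [NumberField K] (b : Basis (Fin 2) ℤ (𝓞 K)) (hb : b 0 = 1) {ℓ : ℕ}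

omit [NumberField K] in
include hb in
/-- **Every residue class mod `ℓ𝓞_K` has a representative in `𝒪_c`** (`ℓ ∤ c`, `ℓ` prime): for
`z = X + Yω` choose `Y'` with `cY' ≡ Y (mod ℓ)`; then `u = X + cY'ω ∈ 𝒪_c` and `z − u ∈ ℓ𝓞_K`. So
`𝒪_c → 𝓞_K/ℓ𝓞_K` is onto. [cite: Cox2013, §7.D proof of (7.27) (𝒪/ℓ𝒪 ≅ 𝒪_K/ℓ𝒪_K for ℓ ∤ f)] -/
theorem exists_mem_quadOrder_sub_eq_natCast_mul (hℓ : ℓ.Prime) (hℓc : ¬ ℓ ∣ c) (z : 𝓞 K) :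
    ∃ u ∈ quadOrder K c, ∃ r : 𝓞 K, (algebraMap (𝓞 K) K z) - u = (ℓ : K) * algebraMap (𝓞 K) K r := by
  obtain ⟨X, Y, -, hz⟩ := (mem_quadOrder_iff_coords b hb (c := 1)).mp
    (show algebraMap (𝓞 K) K z ∈ quadOrder K 1 from ⟨0, z, by simp⟩)
  have hcop : IsCoprime (c : ℤ) (ℓ : ℤ) :=
    Nat.isCoprime_iff_coprime.mpr (Nat.Coprime.symm ((Nat.Prime.coprime_iff_not_dvd hℓ).mpr hℓc))
  obtain ⟨a, q, haq⟩ := hcop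
  -- `Y = c (a Y) + ℓ (q Y)`
  refine ⟨(X : K) + ((c * (a * Y) : ℤ) : K) * omega b, coords_mem_quadOrder b hb (dvd_mul_right _ _),
    (q * Y : ℤ) * b 1, ?_⟩
  have h1 := congrArg (fun t : ℤ => (t : K)) haq
  simp only [map_mul, map_intCast, omega] at hz ⊢
  rw [hz]
  push_cast at h1 ⊢
  linear_combination (-((Y : K) * algebraMap (𝓞 K) K (b 1))) * h1

include hb in
/-- **`𝒪_c ∩ ℓ𝓞_K = ℓ𝒪_c`** for `ℓ ∤ c`: if `ℓ r ∈ 𝒪_c` with `r ∈ 𝓞_K` then `r ∈ 𝒪_c` (compare the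
`ω`-coordinate: `c ∣ ℓS` forces `c ∣ S`). Hence `𝒪_c/ℓ𝒪_c → 𝓞_K/ℓ𝓞_K` is injective. [cite: Cox2013, §7.D proof of (7.27)] -/
theorem mem_quadOrder_of_natCast_mul_mem (hℓ : ℓ.Prime) (hℓc : ¬ ℓ ∣ c) {r : 𝓞 K}
    (hr : (ℓ : K) * algebraMap (𝓞 K) K r ∈ quadOrder K c) : algebraMap (𝓞 K) K r ∈ quadOrder K c := by
  obtain ⟨R, S, -, hRS⟩ := (mem_quadOrder_iff_coords b hb (c := 1)).mp
    (show algebraMap (𝓞 K) K r ∈ quadOrder K 1 from ⟨0, r, by simp⟩)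
  obtain ⟨X, Y, hY, hXY⟩ := (mem_quadOrder_iff_coords b hb).mp hr
  have e : ((ℓ * R : ℤ) : K) + ((ℓ * S : ℤ) : K) * omega b = (X : K) + (Y : K) * omega b := by
    rw [← hXY, hRS]; push_cast; ring
  obtain ⟨-, hS⟩ := coords_unique b hb e
  rw [hRS]
  refine coords_mem_quadOrder b hb ?_
  have hcop : IsCoprime (c : ℤ) (ℓ : ℤ) :=
    Nat.isCoprime_iff_coprime.mpr (Nat.Coprime.symm ((Nat.Prime.coprime_iff_not_dvd hℓ).mpr hℓc))
  exact hcop.dvd_of_dvd_mul_left (by rw [hS]; exact hY)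

end Residues

end QuadOrderTower

end Literature.NumberTheory.EllipticCurves

end
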